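import Summits.ResolutionOfSingularities.ResolutionOfSingularities.Theorems.RadicialJungCleanModelsCleanPermissibleLeadWitness
import HarnessLib

/-!
# Route `RadicialJung`, crux `CleanModels` (stmt-ResolutionOfSingularities-15917), line `Sketch` rev 35, stub 6 `stub_cleanProp44` (X44c):
# CLEAN-PERMISSIBILITY OF `V(t₂, t₁ - t₃^m)` FOR THE LINE OF `t₁` ⟺ `p ∣ m` (contact order with the clean hypersurface)

Seat `leafhand-res-radicialjung-1` g0 (land-only hand).  One-parameter family around the lead's witness
(`RadicialJungCleanModelsCleanPermissibleLeadWitness.lean`, `m = 2`), with the derivation obstruction of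
`RadicialJungCleanModelsCleanPermissibleDerivationObstruction.lean`: in a regular local ring `R` of dimension `3` with regular system of parameters
`(t₁, t₂, t₃)` the regular curve `Y_m = V(t₂, t₁ - t₃^m)` has contact order `m` with the hypersurface `{t₁ = 0}` of the clean representative `t₁`.

* `not_cleanPermissibleAt_contactOrder` — for `m ≥ 2` with `p ∤ m`, `Y_m` is NOT clean-permissible for the line of `t₁` (residue field `p`-perfect,
  partial derivations `∂₂, ∂₃` extending to `F`; NO parity hypothesis on `p` — the lead's witness needed `p` odd only because `m = 2`);
* `cleanPermissibleAt_contactOrder_of_dvd` — for `p ∣ m` it IS clean-permissible (`t₁ - t₃^m` lies on the line; exponent `1`), unconditionally.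
(For `m = 1` it is clean-permissible as well: `t₁` is then a transversal parameter.)

So along this family clean-permissibility is decided by `m mod p`; with the landed L7b (`…ContactChainL7b.lean`) this is the local picture
behind the insertion count of X44c's curve steps.  Honest framing: OURS, elementary; nothing here proves X44c, any case of `CleanModels`, or
resolution of singularities in characteristic `p`.
Setting only: [cite: CossartPiltant2008, Prop. 4.4] [cite: Piltant2013, §2 Axiom 4] [cite: Matsumura1987, Thm. 14.2, Thm. 14.3].
-/

noncomputable section

set_option linter.dupNamespace false -- mandated namespace of this single-conjunct summit

open IsLocalRing
open Literature.AlgebraicGeometry.Resolution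

namespace Summit.ResolutionOfSingularities.ResolutionOfSingularities.Theorems.RadicialJung.CleanModels

universe u v

section ContactOrder

variable {R : Type u} [CommRing R] [IsLocalRing R]

/-- The coordinates `(t₂, t₁ - t₃^m, t₃)` (`m ≥ 1`) generate `𝔪` when `(t₁, t₂, t₃)` do. [folklore] -/
theorem span_contactOrder_coords_eq {t₁ t₂ t₃ : R} (ht : Ideal.span ({t₁, t₂, t₃} : Set R) = maximalIdeal R) {m : ℕ} (hm : 1 ≤ m) :
    Ideal.span ({t₂, t₁ - t₃ ^ m, t₃} : Set R) = maximalIdeal R := by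
  rw [← ht]
  apply le_antisymm
  · rw [Ideal.span_le, Set.insert_subset_iff, Set.insert_subset_iff, Set.singleton_subset_iff]
    refine ⟨Ideal.subset_span (by simp), ?_, Ideal.subset_span (by simp)⟩
    exact Ideal.sub_mem _ (Ideal.subset_span (by simp))
      (Ideal.pow_mem_of_mem _ (Ideal.subset_span (by simp)) _ hm)
  · rw [Ideal.span_le, Set.insert_subset_iff, Set.insert_subset_iff, Set.singleton_subset_iff]
    refine ⟨?_, Ideal.subset_span (by simp), Ideal.subset_span (by simp)⟩
    have h : (t₁ - t₃ ^ m) + t₃ ^ m ∈ Ideal.span ({t₂, t₁ - t₃ ^ m, t₃} : Set R) :=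
      Ideal.add_mem _ (Ideal.subset_span (by simp)) (Ideal.pow_mem_of_mem _ (Ideal.subset_span (by simp)) _ hm)
    rw [SetLike.mem_coe]
    convert h using 1
    ring

/-- The coordinates `(t₂, t₁ - t₃^m, t₃)` (`m ≥ 1`) form a regular system of parameters when `(t₁, t₂, t₃)` do. [folklore] -/
theorem isRsopPart_contactOrder (hR : IsRegularLocalRing R) (hdim : ringKrullDim R = 3) {t₁ t₂ t₃ : R}
    (ht : Ideal.span ({t₁, t₂, t₃} : Set R) = maximalIdeal R) {m : ℕ} (hm : 1 ≤ m) : IsRsopPart ![t₂, t₁ - t₃ ^ m, t₃] := by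
  refine ⟨hR, 0, Fin.elim0, by rw [hdim]; norm_cast, ?_⟩
  have h0 : Set.range (Fin.elim0 : Fin 0 → R) = ∅ := Set.range_eq_empty _
  rw [h0, Set.union_empty]
  have hr : Set.range ![t₂, t₁ - t₃ ^ m, t₃] = {t₂, t₁ - t₃ ^ m, t₃} := by
    ext x
    simp only [Set.mem_range, Set.mem_insert_iff, Set.mem_singleton_iff]
    constructor
    · rintro ⟨i, rfl⟩
      fin_cases i <;> simp
    · rintro (rfl | rfl | rfl)
      exacts [⟨0, rfl⟩, ⟨1, rfl⟩, ⟨2, rfl⟩]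
  rw [hr, span_contactOrder_coords_eq ht hm]

/-- `I = (t₂, t₁ - t₃^m)` is prime and does not contain `t₃` (`m ≥ 1`). [cite: Matsumura1987, Thm. 14.3] -/
theorem contactOrder_isPrime_and_not_mem (hR : IsRegularLocalRing R) (hdim : ringKrullDim R = 3) {t₁ t₂ t₃ : R}
    (ht : Ideal.span ({t₁, t₂, t₃} : Set R) = maximalIdeal R) {m : ℕ} (hm : 1 ≤ m) :
    (Ideal.span ({t₂, t₁ - t₃ ^ m} : Set R)).IsPrime ∧ t₃ ∉ Ideal.span ({t₂, t₁ - t₃ ^ m} : Set R) := by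
  have hz := isRsopPart_contactOrder hR hdim ht hm
  have himg : (![t₂, t₁ - t₃ ^ m, t₃] : Fin 3 → R) '' ({0, 1} : Set (Fin 3)) = {t₂, t₁ - t₃ ^ m} := by
    rw [Set.image_insert_eq, Set.image_singleton]
    rfl
  have hcomp : Set.range ((![t₂, t₁ - t₃ ^ m, t₃] : Fin 3 → R) ∘ Fin.castLE (by norm_num : 2 ≤ 3)) = {t₂, t₁ - t₃ ^ m} := by
    ext x
    simp only [Set.mem_range, Function.comp_apply, Set.mem_insert_iff, Set.mem_singleton_iff]
    constructor
    · rintro ⟨i, rfl⟩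
      fin_cases i
      · exact Or.inl rfl
      · exact Or.inr rfl
    · rintro (rfl | rfl)
      · exact ⟨0, rfl⟩
      · exact ⟨1, rfl⟩
  refine ⟨?_, ?_⟩
  · have h := (hz.comp (Fin.castLE (by norm_num : 2 ≤ 3)) (Fin.castLE_injective _)).isPrime_span_range
    rwa [hcomp] at h
  · have h := hz.not_mem_span_image (S := ({0, 1} : Set (Fin 3))) (i := 2) (by decide)
    rwa [himg] at h

/-- Contact order, step (i): a minimal generator `x` of `I = (t₂, t₁ - t₃^m)` (`m ≥ 1`, `p ∤ m`) with `x ∣ ∂₃ x` has `x ∤ ∂₂ x`.  Writing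
`x = α t₂ + β (t₁ - t₃^m)`: `∂₃ x ≡ -m β t₃^{m-1} (mod I)`, so `x ∣ ∂₃ x` forces `β ∈ I` (`I` prime, `t₃ ∉ I`, `m` a unit), hence `α` is a unit
(`x ∉ 𝔪²`) and `∂₂ x ≡ α` is a unit. [cite: Matsumura1987, Thm. 14.2] -/
theorem contactOrder_gen (hR : IsRegularLocalRing R) (hdim : ringKrullDim R = 3) {p : ℕ} [Fact p.Prime] [CharP R p] {m : ℕ}
    (hm : 1 ≤ m) (hpm : ¬ p ∣ m)
    {t₁ t₂ t₃ : R} (ht : Ideal.span ({t₁, t₂, t₃} : Set R) = maximalIdeal R) (d₂ d₃ : Derivation ℤ R R)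
    (h22 : d₂ t₂ = 1) (h31 : d₃ t₁ = 0) (h32 : d₃ t₂ = 0) (h33 : d₃ t₃ = 1) {x : R}
    (hxI : x ∈ Ideal.span ({t₂, t₁ - t₃ ^ m} : Set R)) (hx2 : x ∉ maximalIdeal R ^ 2) (hdvd₃ : x ∣ d₃ x) : ¬ x ∣ d₂ x := by
  set s : R := t₁ - t₃ ^ m with hs
  set I : Ideal R := Ideal.span ({t₂, s} : Set R) with hI
  obtain ⟨hIprime, ht₃I⟩ := contactOrder_isPrime_and_not_mem hR hdim ht hm
  have hIm : I ≤ maximalIdeal R := IsLocalRing.le_maximalIdeal hIprime.ne_top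
  have ht₂I : t₂ ∈ I := Ideal.subset_span (by simp)
  have hsI : s ∈ I := Ideal.subset_span (by simp)
  have ht₂m : t₂ ∈ maximalIdeal R := hIm ht₂I
  have hsm : s ∈ maximalIdeal R := hIm hsI
  have ht₃m : t₃ ∈ maximalIdeal R := ht ▸ Ideal.subset_span (by simp)
  obtain ⟨α, β, hx⟩ := Ideal.mem_span_pair.mp hxI
  -- `d₃ s = -m t₃^(m-1)`, `d₃ x ≡ -m β t₃^(m-1) (mod I)`
  have hd₃s : d₃ s = -((m : R) * t₃ ^ (m - 1)) := by
    rw [hs, map_sub, Derivation.leibniz_pow, h31, h33]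
    simp only [smul_eq_mul, nsmul_eq_mul, mul_one]
    ring
  have hcalc : d₃ x = t₂ * d₃ α + s * d₃ β - (m : R) * (β * t₃ ^ (m - 1)) := by
    rw [← hx, map_add, Derivation.leibniz, Derivation.leibniz, h32, hd₃s]
    simp only [smul_eq_mul]
    ring
  -- `x ∣ d₃ x` puts `m β t₃^(m-1)` in `I`
  have hmβt : (m : R) * (β * t₃ ^ (m - 1)) ∈ I := by
    have hdx : d₃ x ∈ I := by
      obtain ⟨r, hr⟩ := hdvd₃
      rw [hr]
      exact Ideal.mul_mem_right _ _ hxI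
    have : (m : R) * (β * t₃ ^ (m - 1)) = t₂ * d₃ α + s * d₃ β - d₃ x := by rw [hcalc]; ring
    rw [this]
    exact Ideal.sub_mem _ (Ideal.add_mem _ (Ideal.mul_mem_right _ _ ht₂I) (Ideal.mul_mem_right _ _ hsI)) hdx
  have hmu : IsUnit (m : R) := isUnit_natCast_of_not_dvd p (S := R) hpm
  have hβt : β * t₃ ^ (m - 1) ∈ I := (Ideal.unit_mul_mem_iff_mem I hmu).mp hmβt
  have hβ : β ∈ I := by
    rcases hIprime.mem_or_mem hβt with hβ | ht
    · exact hβ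
    · exact absurd (hIprime.mem_of_pow_mem _ ht) ht₃I
  -- hence `α` is a unit
  have hα : IsUnit α := by
    by_contra hα
    have hαm : α ∈ maximalIdeal R := (IsLocalRing.mem_maximalIdeal α).mpr hα
    apply hx2
    rw [← hx, pow_two]
    exact Ideal.add_mem _ (Ideal.mul_mem_mul hαm ht₂m) (Ideal.mul_mem_mul (hIm hβ) hsm)
  -- and `d₂ x ≡ α (mod 𝔪)` is a unit, which `x ∈ 𝔪` cannot divide
  have hd₂x : d₂ x = α + (t₂ * d₂ α + s * d₂ β + β * d₂ s) := by
    rw [← hx, map_add, Derivation.leibniz, Derivation.leibniz, h22]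
    simp only [smul_eq_mul]
    ring
  have hrest : t₂ * d₂ α + s * d₂ β + β * d₂ s ∈ maximalIdeal R :=
    Ideal.add_mem _ (Ideal.add_mem _ (Ideal.mul_mem_right _ _ ht₂m) (Ideal.mul_mem_right _ _ hsm))
      (Ideal.mul_mem_right _ _ (hIm hβ))
  have hunit : IsUnit (d₂ x) := by
    by_contra hnu
    have hm : d₂ x ∈ maximalIdeal R := (IsLocalRing.mem_maximalIdeal _).mpr hnu
    have : α ∈ maximalIdeal R := by
      have h := Ideal.sub_mem _ hm hrest
      rwa [hd₂x, add_sub_cancel_right] at h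
    exact (IsLocalRing.mem_maximalIdeal α).mp this hα
  intro hdvd₂
  exact (IsLocalRing.mem_maximalIdeal x).mp (hIm hxI) (isUnit_of_dvd_unit hdvd₂ hunit)

/-- Contact order, step (ii): a parameter `x` transversal to `I = (t₂, t₁ - t₃^m)` (`m ≥ 2`; `x ∈ 𝔪 ∖ (I + 𝔪²)`) has `x ∤ ∂₃ x`: writing
`x = A t₁ + B t₂ + Γ t₃`, transversality forces `Γ` to be a unit (`t₁, t₂ ∈ I + 𝔪²`), and `∂₃ x ≡ Γ (mod 𝔪)`.
[cite: Matsumura1987, Thm. 14.2] -/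
theorem contactOrder_trans {t₁ t₂ t₃ : R} (ht : Ideal.span ({t₁, t₂, t₃} : Set R) = maximalIdeal R) {m : ℕ} (hm : 2 ≤ m)
    (d₃ : Derivation ℤ R R)
    (h31 : d₃ t₁ = 0) (h32 : d₃ t₂ = 0) (h33 : d₃ t₃ = 1) {x : R} (hxm : x ∈ maximalIdeal R)
    (hx2 : x ∉ Ideal.span ({t₂, t₁ - t₃ ^ m} : Set R) ⊔ maximalIdeal R ^ 2) : ¬ x ∣ d₃ x := by
  set I : Ideal R := Ideal.span ({t₂, t₁ - t₃ ^ m} : Set R) with hI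
  have ht₁m : t₁ ∈ maximalIdeal R := ht ▸ Ideal.subset_span (by simp)
  have ht₂m : t₂ ∈ maximalIdeal R := ht ▸ Ideal.subset_span (by simp)
  have ht₃m : t₃ ∈ maximalIdeal R := ht ▸ Ideal.subset_span (by simp)
  obtain ⟨A, B, Γ, hx⟩ := exists_eq_combination_of_mem_span_triple (ht ▸ hxm : x ∈ Ideal.span ({t₁, t₂, t₃} : Set R))
  -- `t₁, t₂ ∈ I + 𝔪²`
  have ht₂J : t₂ ∈ I ⊔ maximalIdeal R ^ 2 := Ideal.mem_sup_left (Ideal.subset_span (by simp))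
  have ht₁J : t₁ ∈ I ⊔ maximalIdeal R ^ 2 := by
    have h : t₁ = (t₁ - t₃ ^ m) + t₃ ^ m := by ring
    rw [h]
    exact Ideal.add_mem _ (Ideal.mem_sup_left (Ideal.subset_span (by simp)))
      (Ideal.mem_sup_right (Ideal.pow_le_pow_right hm (Ideal.pow_mem_pow ht₃m m)))
  -- so `Γ` is a unit
  have hΓ : IsUnit Γ := by
    by_contra hΓ
    have hΓm : Γ ∈ maximalIdeal R := (IsLocalRing.mem_maximalIdeal Γ).mpr hΓ
    apply hx2
    rw [hx]
    refine Ideal.add_mem _ (Ideal.add_mem _ (Ideal.mul_mem_left _ _ ht₁J) (Ideal.mul_mem_left _ _ ht₂J))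
      (Ideal.mem_sup_right ?_)
    rw [pow_two]
    exact Ideal.mul_mem_mul hΓm ht₃m
  -- `d₃ x ≡ Γ (mod 𝔪)`
  have hd₃x : d₃ x = Γ + (t₁ * d₃ A + t₂ * d₃ B + t₃ * d₃ Γ) := by
    rw [hx, map_add, map_add, Derivation.leibniz, Derivation.leibniz, Derivation.leibniz, h31, h32, h33]
    simp only [smul_eq_mul]
    ring
  have hrest : t₁ * d₃ A + t₂ * d₃ B + t₃ * d₃ Γ ∈ maximalIdeal R :=
    Ideal.add_mem _ (Ideal.add_mem _ (Ideal.mul_mem_right _ _ ht₁m) (Ideal.mul_mem_right _ _ ht₂m))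
      (Ideal.mul_mem_right _ _ ht₃m)
  have hunit : IsUnit (d₃ x) := by
    by_contra hnu
    have hm : d₃ x ∈ maximalIdeal R := (IsLocalRing.mem_maximalIdeal _).mpr hnu
    have : Γ ∈ maximalIdeal R := by
      have h := Ideal.sub_mem _ hm hrest
      rwa [hd₃x, add_sub_cancel_right] at h
    exact (IsLocalRing.mem_maximalIdeal Γ).mp this hΓ
  intro hdvd
  exact (IsLocalRing.mem_maximalIdeal x).mp hxm (isUnit_of_dvd_unit hdvd hunit)

/-- **Contact order prime to `p` obstructs.**  `R` regular local of dimension `3` with regular system of parameters `(t₁, t₂, t₃)`, embedded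
by `f` in a field `F` of characteristic `p`, residue field `p`-perfect, derivations `∂₂, ∂₃` (`∂₂ t₁ = 0`, `∂₂ t₂ = 1`, `∂₃ t₁ = ∂₃ t₂ = 0`,
`∂₃ t₃ = 1`) extending along `f`.  For `m ≥ 2` with `p ∤ m`, the regular curve `Y_m = V(t₂, t₁ - t₃^m)` — which has contact order `m` with the
hypersurface `{t₁ = 0}` of the clean representative — is NOT clean-permissible for the line of `G = t₁` (the lead's witness is `m = 2`, `p` odd).
For `p ∣ m` it IS (`cleanPermissibleAt_contactOrder_of_dvd`), and for `m = 1` it is too (`t₁` is then a transversal parameter).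
[cite: Piltant2013, §2 Axiom 4] [cite: CossartPiltant2008, Prop. 4.4] -/
theorem not_cleanPermissibleAt_contactOrder {R : Type u} {F : Type u} [CommRing R] [IsLocalRing R] [Field F] {p : ℕ} [Fact p.Prime]
    [CharP F p] {m : ℕ} (hm : 2 ≤ m) (hpm : ¬ p ∣ m) {f : R →+* F} (hf : Function.Injective f) (hR : IsRegularLocalRing R)
    (hdim : ringKrullDim R = 3) {t₁ t₂ t₃ : R} (ht : Ideal.span ({t₁, t₂, t₃} : Set R) = maximalIdeal R)
    (hperf : ∀ u : R, ∃ c : R, u - c ^ p ∈ maximalIdeal R)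
    (d₂ d₃ : Derivation ℤ R R) (D₂ D₃ : Derivation ℤ F F) (hD₂ : ∀ r, D₂ (f r) = f (d₂ r)) (hD₃ : ∀ r, D₃ (f r) = f (d₃ r))
    (h21 : d₂ t₁ = 0) (h22 : d₂ t₂ = 1) (h31 : d₃ t₁ = 0) (h32 : d₃ t₂ = 0) (h33 : d₃ t₃ = 1) :
    ¬ CleanPermissibleAt p f (f t₁) (Ideal.span ({t₂, t₁ - t₃ ^ m} : Set R)) := by
  haveI : CharP R p := f.charP hf p
  have hD₂G : D₂ (f t₁) = 0 := by rw [hD₂, h21, map_zero]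
  have hD₃G : D₃ (f t₁) = 0 := by rw [hD₃, h31, map_zero]
  refine not_cleanPermissibleAt_of_derivations hf hperf (fun x hxI hx2 => ?_) (fun x hxm hx2 => ?_)
  · by_cases hdvd₃ : x ∣ d₃ x
    · exact ⟨D₂, d₂, hD₂, hD₂G, contactOrder_gen hR hdim (by omega) hpm ht d₂ d₃ h22 h31 h32 h33 hxI hx2 hdvd₃⟩
    · exact ⟨D₃, d₃, hD₃, hD₃G, hdvd₃⟩
  · exact ⟨D₃, d₃, hD₃, hD₃G, contactOrder_trans ht hm d₃ h31 h32 h33 hxm hx2⟩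

/-- **… and contact order divisible by `p` does not**: for `p ∣ m` (`m ≥ 1`), `t₁ - t₃^m = t₁ - (t₃^{m/p})^p` is itself a representative of the
line of `t₁`, of loose clean form (1) with exponent `1` in the adapted system `(t₂, t₁ - t₃^m; t₃)`, so `Y_m = V(t₂, t₁ - t₃^m)` IS clean-permissible
(any characteristic, any residue field, no derivations needed). [cite: Piltant2013, §2 Axiom 4] -/
theorem cleanPermissibleAt_contactOrder_of_dvd {F : Type v} [Field F] {p : ℕ} [hp : Fact p.Prime] [CharP F p] (f : R →+* F)
    (hR : IsRegularLocalRing R) (hdim : ringKrullDim R = 3) {t₁ t₂ t₃ : R} (ht : Ideal.span ({t₁, t₂, t₃} : Set R) = maximalIdeal R)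
    {m : ℕ} (hm : 1 ≤ m) (hpm : p ∣ m) :
    CleanPermissibleAt p f (f t₁) (Ideal.span ({t₂, t₁ - t₃ ^ m} : Set R)) := by
  classical
  obtain ⟨q, rfl⟩ := hpm
  have h1p : 1 < p := hp.out.one_lt
  have h01 : (⟨0, hp.out.pos⟩ : Fin p) ≠ ⟨1, h1p⟩ := by simp
  -- the representative `(-t₃^q)^p · t₁^0 + 1^p · t₁^1 = t₁ - t₃^(p q)`
  let cc : Fin p → F := Pi.single (⟨0, hp.out.pos⟩ : Fin p) (-f (t₃ ^ q)) + Pi.single (⟨1, h1p⟩ : Fin p) 1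
  have hsum : (∑ j : Fin p, cc j ^ p * f t₁ ^ (j : ℕ)) = f (t₁ - t₃ ^ (p * q)) := by
    rw [Fintype.sum_eq_add (⟨0, hp.out.pos⟩ : Fin p) ⟨1, h1p⟩ h01]
    · simp only [cc, Pi.add_apply, Pi.single_eq_same, Pi.single_eq_of_ne h01.symm, Pi.single_eq_of_ne h01, add_zero,
        zero_add, one_pow, one_mul, pow_zero, mul_one, pow_one, map_sub, map_pow]
      rw [neg_pow, neg_one_pow_char F p, ← pow_mul, mul_comm q p]
      ring
    · intro j ⟨hj0, hj1⟩
      simp only [cc, Pi.add_apply, Pi.single_eq_of_ne hj0, Pi.single_eq_of_ne hj1, add_zero, zero_pow hp.out.ne_zero, zero_mul]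
  refine ⟨hR, 2, 1, ![t₂, t₁ - t₃ ^ (p * q)], ![t₃], ?_, by rw [hdim]; norm_cast, ?_, cc, ⟨⟨1, h1p⟩, one_ne_zero, ?_⟩,
    Or.inl ⟨![0, 1], ![0], 1, isUnit_one, Or.inl ⟨1, by simpa using hp.out.one_lt.ne'⟩, ?_⟩⟩
  · have happ : Fin.append ![t₂, t₁ - t₃ ^ (p * q)] ![t₃] = ![t₂, t₁ - t₃ ^ (p * q), t₃] := by
      ext i; fin_cases i <;> rfl
    have hr : Set.range ![t₂, t₁ - t₃ ^ (p * q), t₃] = {t₂, t₁ - t₃ ^ (p * q), t₃} := by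
      ext a
      simp only [Set.mem_range, Set.mem_insert_iff, Set.mem_singleton_iff]
      constructor
      · rintro ⟨i, rfl⟩
        fin_cases i <;> simp
      · rintro (rfl | rfl | rfl)
        exacts [⟨0, rfl⟩, ⟨1, rfl⟩, ⟨2, rfl⟩]
    rw [happ, hr, span_contactOrder_coords_eq ht hm]
  · congr 1
    ext a
    simp only [Set.mem_range, Set.mem_insert_iff, Set.mem_singleton_iff]
    constructor
    · rintro ⟨i, rfl⟩
      fin_cases i <;> simp
    · rintro (rfl | rfl)
      exacts [⟨0, rfl⟩, ⟨1, rfl⟩]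
  · simp [cc]
  · rw [hsum]
    simp

end ContactOrder

end Summit.ResolutionOfSingularities.ResolutionOfSingularities.Theorems.RadicialJung.CleanModels

end
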